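import Summits.AtomisticToContinuum.BoseEinsteinCondensation.Theorems.BECInsertionCorrectorCorrectorClosureNearMinimiserRigidity
import Literature.MathematicalPhysics.QuantumManyBody.PeriodicBoseGasTagged
import HarnessLib

/-!
# Crux `CorrectorClosure` (stmt-AtomisticToContinuum-12058), line `residue-area-law` —
# registered stub `stub_occupationFloorFK_of_window`: a near-minimiser BEC window reaches the
# Feynman–Kac ground state (fixed `N`, `L`)

Supports (does not close) stmt-AtomisticToContinuum-12058, route `BECInsertionCorrector`.

**Statement.** In a box `L > 0` with bounded periodised potential `v^per`, let
`Φ₀ : Config (N+1) → ℝ` be the continuous positive torus Feynman–Kac ground state of `N + 1`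
bodies (`IsPeriodicGroundStateFK v L Φ₀`). If for some `δ > 0` every periodic `δ`-near-minimiser
`Ψ` of the `(N+1)`-body energy has `condensateOccupation (N+1) L Ψ ≥ c (N+1)` (`0 ≤ c`), then the
one-particle zero-mode occupation of `Φ₀` itself is at least `c`:
`ENNReal.ofReal c ≤ taggedZeroModeOccupation N L Φ₀` (`stub_occupationFloorFK_of_window`, the
registered signature verbatim).

**Proof.** Write `f₀(Ψ) = taggedZeroModeOccupation N L Ψ = L⁻³ ∫_{cell^N} |∫_cell Ψ(x, Y) dx|² dY`
(`= condensateOccupation (N+1) L Ψ / (N+1)`, `succ_mul_taggedZeroModeOccupation`), so the window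
hypothesis says `c ≤ f₀(Ψ)` for every `δ`-near-minimiser `Ψ`. Three elementary properties of `f₀`
(it is `‖PΨ‖²` for the contraction `P` = zero-mode projection of particle `0`):
* contraction: `f₀(F) ≤ ∫_{cell^{N+1}} |F|²` (Cauchy–Schwarz in `x` slice by slice, Tonelli;
  `taggedZeroModeOccupation_le_lintegral`),
* homogeneity: `f₀(αF) = |α|² f₀(F)` (`taggedZeroModeOccupation_const_mul`),
* quasi-subadditivity: `f₀(F + G) ≤ (1+ε) f₀(F) + (1+ε⁻¹) f₀(G)` for every `ε > 0` (the pointwise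
  Young inequality `|a+b|² ≤ (1+ε)|a|² + (1+ε⁻¹)|b|²` under the `Y`-integral;
  `taggedZeroModeOccupation_add_le`).
Fix `ε > 0` and put `η = ε²/(1+ε)`. Rigidity at fixed `N` (`rigidity_of_nearMinimiser`) gives
`δ_η > 0` such that every `δ_η`-near-minimiser `Ψ` has `∫_{cell^{N+1}} |Ψ − αΦ₀|² ≤ η` for some
`|α| ≤ 1`; a `min(δ, δ_η)`-near-minimiser `Ψ` exists (`E₀ < ⊤`, definition of the infimum). Then
`c ≤ f₀(Ψ) = f₀(αΦ₀ + (Ψ − αΦ₀)) ≤ (1+ε)|α|² f₀(Φ₀) + (1+ε⁻¹) η ≤ (1+ε) f₀(Φ₀) + ε`, and since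
`f₀(Φ₀) ≤ ∫ Φ₀² = 1`, `c ≤ f₀(Φ₀) + 2ε` for every `ε > 0` (`ENNReal.le_of_forall_pos_le_add`).

## References

* [Fournais2020] S. Fournais, *Length scales for BEC in the dilute Bose gas*, (1.3)–(1.5)
  (`P_Ω`, `n₀`; `0 ≤ P_Ω ≤ 1`).
* [ReedSimonIV1978] M. Reed, B. Simon, *Methods of Modern Mathematical Physics IV*, Thm XIII.44
  (nondegenerate positive ground state; the rigidity input).
-/

noncomputable section

open MeasureTheory Filter Matrix
open scoped ENNReal NNReal BigOperators ComplexConjugate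

namespace Summit.AtomisticToContinuum.BoseEinsteinCondensation.Theorems.CorrectorClosure.ResidueAreaLaw

open Literature.MathematicalPhysics.QuantumManyBody.BoseGas
open Summit.AtomisticToContinuum.BoseEinsteinCondensation.Theorems.CorrectorClosure.HealingScaleKacInsertion
  (rigidity_of_nearMinimiser lintegral_nnnorm_ofReal_sq_eq_one exists_norm_le_of_continuous_periodic)

variable {N : ℕ} {L : ℝ}

/-! ### The pointwise Young inequality -/

/-- `|a + b|² ≤ (1+ε)|a|² + (1+ε⁻¹)|b|²` for complex `a, b` and `ε > 0`, in `[0, ∞]`. [folklore] -/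
theorem nnnorm_add_sq_le_young (a b : ℂ) {ε : ℝ} (hε : 0 < ε) :
    ((‖a + b‖₊ : ℝ≥0∞)) ^ 2 ≤ ENNReal.ofReal (1 + ε) * (‖a‖₊ : ℝ≥0∞) ^ 2 +
      ENNReal.ofReal (1 + ε⁻¹) * (‖b‖₊ : ℝ≥0∞) ^ 2 := by
  have ha := norm_nonneg a
  have hb := norm_nonneg b
  have hε0 : ε ≠ 0 := hε.ne'
  have hkey : ‖a + b‖ ^ 2 ≤ (1 + ε) * ‖a‖ ^ 2 + (1 + ε⁻¹) * ‖b‖ ^ 2 := by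
    have h1 : ‖a + b‖ ^ 2 ≤ (‖a‖ + ‖b‖) ^ 2 := pow_le_pow_left₀ (norm_nonneg _) (norm_add_le a b) 2
    have h3 : 0 ≤ (ε * ‖a‖ - ‖b‖) ^ 2 / ε := by positivity
    have h4 : (1 + ε) * ‖a‖ ^ 2 + (1 + ε⁻¹) * ‖b‖ ^ 2 - (‖a‖ + ‖b‖) ^ 2 =
        (ε * ‖a‖ - ‖b‖) ^ 2 / ε := by
      field_simp
      ring
    linarith
  rw [nnnorm_coe_sq_eq_ofReal, nnnorm_coe_sq_eq_ofReal, nnnorm_coe_sq_eq_ofReal,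
    ← ENNReal.ofReal_mul (by positivity), ← ENNReal.ofReal_mul (by positivity),
    ← ENNReal.ofReal_add (by positivity) (by positivity)]
  exact ENNReal.ofReal_le_ofReal hkey

/-! ### The tagged zero-mode occupation as a contraction: bound, homogeneity, quasi-subadditivity -/

/-- **Slice Cauchy–Schwarz + Tonelli**: `∫_{cell^N} |∫_cell F(x, Y) dx|² dY ≤ L³ ∫_{cell^{N+1}} |F|²`
for measurable `F`. [folklore] -/
theorem lintegral_sq_setIntegral_vecCons_le (L : ℝ) {F : Config (N + 1) → ℂ} (hF : Measurable F) :
    ∫⁻ Y in cellN N L, (‖∫ x in cell L, F (vecCons x Y)‖₊ : ℝ≥0∞) ^ 2 ≤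
      ENNReal.ofReal L ^ 3 * ∫⁻ X in cellN (N + 1) L, (‖F X‖₊ : ℝ≥0∞) ^ 2 := by
  have hFn : Measurable fun X => (‖F X‖₊ : ℝ≥0∞) ^ 2 := (hF.nnnorm.coe_nnreal_ennreal).pow_const _
  have hL3' : ENNReal.ofReal L ^ 3 ≠ ⊤ := ENNReal.pow_ne_top ENNReal.ofReal_ne_top
  have hslice : ∀ Y : Config N, (‖∫ x in cell L, F (vecCons x Y)‖₊ : ℝ≥0∞) ^ 2 ≤
      ENNReal.ofReal L ^ 3 * ∫⁻ x in cell L, (‖F (vecCons x Y)‖₊ : ℝ≥0∞) ^ 2 := by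
    intro Y
    have h := sq_nnnorm_integral_mul_conj_le (ν := volume.restrict (cell L))
      (f := fun x => F (vecCons x Y)) (g := fun _ => (1 : ℂ))
      (measurable_comp_vecCons_left hF Y).aemeasurable aemeasurable_const
    simp only [map_one, mul_one, nnnorm_one, ENNReal.coe_one, one_pow, lintegral_const,
      Measure.restrict_apply_univ, volume_cell, one_mul] at h
    exact h.trans_eq (mul_comm _ _)
  calc ∫⁻ Y in cellN N L, (‖∫ x in cell L, F (vecCons x Y)‖₊ : ℝ≥0∞) ^ 2
      ≤ ∫⁻ Y in cellN N L, ENNReal.ofReal L ^ 3 *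
          ∫⁻ x in cell L, (‖F (vecCons x Y)‖₊ : ℝ≥0∞) ^ 2 := lintegral_mono hslice
    _ = _ := by rw [lintegral_const_mul' _ _ hL3', setLIntegral_cellN_succ_right hFn]

/-- **The zero-mode projection of particle `0` is a contraction**:
`taggedZeroModeOccupation N L F ≤ ∫_{cell^{N+1}} |F|²` for measurable `F` and `L > 0`. [folklore] -/
theorem taggedZeroModeOccupation_le_lintegral (hL : 0 < L) {F : Config (N + 1) → ℂ}
    (hF : Measurable F) :
    taggedZeroModeOccupation N L F ≤ ∫⁻ X in cellN (N + 1) L, (‖F X‖₊ : ℝ≥0∞) ^ 2 := by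
  have hL3 : ENNReal.ofReal L ^ 3 ≠ 0 := pow_ne_zero _ (ENNReal.ofReal_pos.2 hL).ne'
  have hL3' : ENNReal.ofReal L ^ 3 ≠ ⊤ := ENNReal.pow_ne_top ENNReal.ofReal_ne_top
  rw [taggedZeroModeOccupation_def]
  calc (ENNReal.ofReal L ^ 3)⁻¹ *
        ∫⁻ Y in cellN N L, (‖∫ x in cell L, F (vecCons x Y)‖₊ : ℝ≥0∞) ^ 2
      ≤ (ENNReal.ofReal L ^ 3)⁻¹ * (ENNReal.ofReal L ^ 3 *
          ∫⁻ X in cellN (N + 1) L, (‖F X‖₊ : ℝ≥0∞) ^ 2) :=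
        mul_le_mul_right (lintegral_sq_setIntegral_vecCons_le L hF) _
    _ = _ := by rw [← mul_assoc, ENNReal.inv_mul_cancel hL3 hL3', one_mul]

/-- **Homogeneity**: `taggedZeroModeOccupation N L (αF) = |α|² · taggedZeroModeOccupation N L F`.
[folklore] -/
theorem taggedZeroModeOccupation_const_mul (N : ℕ) (L : ℝ) (α : ℂ) (F : Config (N + 1) → ℂ) :
    taggedZeroModeOccupation N L (fun X => α * F X) =
      (‖α‖₊ : ℝ≥0∞) ^ 2 * taggedZeroModeOccupation N L F := by
  simp only [taggedZeroModeOccupation_def]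
  simp_rw [integral_const_mul, nnnorm_mul, ENNReal.coe_mul, mul_pow]
  rw [lintegral_const_mul' _ _ (ENNReal.pow_ne_top ENNReal.coe_ne_top)]
  ring

/-- **Quasi-subadditivity** (Young): for measurable `F, G` with integrable cell slices and `ε > 0`,
`taggedZeroModeOccupation N L (F + G) ≤ (1+ε) taggedZeroModeOccupation N L F +
(1+ε⁻¹) taggedZeroModeOccupation N L G`. [folklore] -/
theorem taggedZeroModeOccupation_add_le {F G : Config (N + 1) → ℂ} (hF : Measurable F)
    (hG : Measurable G) (hFi : ∀ Y : Config N, IntegrableOn (fun x => F (vecCons x Y)) (cell L))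
    (hGi : ∀ Y : Config N, IntegrableOn (fun x => G (vecCons x Y)) (cell L)) {ε : ℝ} (hε : 0 < ε) :
    taggedZeroModeOccupation N L (fun X => F X + G X) ≤
      ENNReal.ofReal (1 + ε) * taggedZeroModeOccupation N L F +
        ENNReal.ofReal (1 + ε⁻¹) * taggedZeroModeOccupation N L G := by
  have hFm : Measurable fun Y : Config N => (‖∫ x in cell L, F (vecCons x Y)‖₊ : ℝ≥0∞) ^ 2 :=
    ((measurable_setIntegral_vecCons hF _).nnnorm.coe_nnreal_ennreal).pow_const _
  have hGm : Measurable fun Y : Config N => (‖∫ x in cell L, G (vecCons x Y)‖₊ : ℝ≥0∞) ^ 2 :=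
    ((measurable_setIntegral_vecCons hG _).nnnorm.coe_nnreal_ennreal).pow_const _
  have hpt : ∀ Y : Config N,
      (‖∫ x in cell L, (F (vecCons x Y) + G (vecCons x Y))‖₊ : ℝ≥0∞) ^ 2 ≤
      ENNReal.ofReal (1 + ε) * (‖∫ x in cell L, F (vecCons x Y)‖₊ : ℝ≥0∞) ^ 2 +
        ENNReal.ofReal (1 + ε⁻¹) * (‖∫ x in cell L, G (vecCons x Y)‖₊ : ℝ≥0∞) ^ 2 := by
    intro Y
    rw [integral_add (hFi Y) (hGi Y)]
    exact nnnorm_add_sq_le_young _ _ hε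
  simp only [taggedZeroModeOccupation_def]
  calc (ENNReal.ofReal L ^ 3)⁻¹ *
        ∫⁻ Y in cellN N L, (‖∫ x in cell L, (F (vecCons x Y) + G (vecCons x Y))‖₊ : ℝ≥0∞) ^ 2
      ≤ (ENNReal.ofReal L ^ 3)⁻¹ * ∫⁻ Y in cellN N L,
          (ENNReal.ofReal (1 + ε) * (‖∫ x in cell L, F (vecCons x Y)‖₊ : ℝ≥0∞) ^ 2 +
            ENNReal.ofReal (1 + ε⁻¹) * (‖∫ x in cell L, G (vecCons x Y)‖₊ : ℝ≥0∞) ^ 2) :=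
        mul_le_mul_right (lintegral_mono hpt) _
    _ = _ := by
        rw [lintegral_add_left (hFm.const_mul _), lintegral_const_mul _ hFm,
          lintegral_const_mul _ hGm]
        ring

/-! ### The stub -/

/-- **Stub `stub_occupationFloorFK_of_window` of line `residue-area-law` — fixed-`N` bridge: a
near-minimiser BEC window reaches the FK ground state.** In a box `L > 0` with bounded `v^per`, let
`Φ₀` be the continuous positive torus FK ground state of `N+1` bodies. If for some `δ > 0` every
periodic `δ`-near-minimiser `Ψ` of the `(N+1)`-body energy has
`condensateOccupation (N+1) L Ψ ≥ c(N+1)`, then the one-particle zero-mode occupation of `Φ₀` itself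
is `≥ c`: `ENNReal.ofReal c ≤ taggedZeroModeOccupation N L Φ₀`. Proof: for `ε > 0` and
`η = ε²/(1+ε)`, `rigidity_of_nearMinimiser` gives `δ_η > 0` such that `δ_η`-near-minimisers satisfy
`‖Ψ − αΦ₀‖²_cell ≤ η`, `|α| ≤ 1`; a `min(δ, δ_η)`-near-minimiser exists (`iInf_lt_iff`, `E₀ < ⊤`);
`taggedZeroModeOccupation = condensateOccupation/(N+1)` (`succ_mul_taggedZeroModeOccupation`) is a
contraction, `|α|²`-homogeneous and quasi-subadditive (Young), so
`c ≤ f₀(Ψ) ≤ (1+ε)|α|² f₀(Φ₀) + (1+ε⁻¹)η ≤ (1+ε) f₀(Φ₀) + ε ≤ f₀(Φ₀) + 2ε` (`f₀(Φ₀) ≤ 1`); let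
`ε → 0` (`ENNReal.le_of_forall_pos_le_add`). [folklore] -/
theorem stub_occupationFloorFK_of_window (v : ℝ → ℝ≥0∞) (hv : Measurable v) (N : ℕ) (L : ℝ)
    (hL : 0 < L) (hb : ∃ C : ℝ≥0, ∀ x, periodizedPotential v L x ≤ C)
    (Φ₀ : Config (N + 1) → ℝ) (hΦ : IsPeriodicGroundStateFK v L Φ₀) (hΦc : Continuous Φ₀)
    (hΦp : ∀ X, 0 < Φ₀ X) (c : ℝ) (hc : 0 ≤ c) (δ : ℝ≥0∞) (hδ : 0 < δ)
    (hwin : ∀ Ψ : PeriodicTrialState (N + 1) L,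
      periodicEnergy v Ψ ≤ periodicGroundStateEnergy v (N + 1) L + δ →
      ENNReal.ofReal (c * ((N : ℝ) + 1)) ≤ condensateOccupation (N + 1) L Ψ.ψ) :
    ENNReal.ofReal c ≤ taggedZeroModeOccupation N L (fun X => (Φ₀ X : ℂ)) := by
  obtain ⟨C, hC⟩ := hb
  have hΦ₀m : Measurable fun Z => (Φ₀ Z : ℂ) := Complex.measurable_ofReal.comp hΦ.measurable
  -- Step 1: every `δ`-near-minimiser has `f₀ ≥ c` (cancel the factor `N + 1`)
  have hN0 : (N + 1 : ℝ≥0∞) ≠ 0 := by positivity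
  have hNtop : (N + 1 : ℝ≥0∞) ≠ ⊤ :=
    ENNReal.add_ne_top.2 ⟨ENNReal.natCast_ne_top N, ENNReal.one_ne_top⟩
  have hNreal : ENNReal.ofReal ((N : ℝ) + 1) = (N + 1 : ℝ≥0∞) := by
    rw [ENNReal.ofReal_add (Nat.cast_nonneg N) zero_le_one, ENNReal.ofReal_natCast,
      ENNReal.ofReal_one]
  have hwin' : ∀ Ψ : PeriodicTrialState (N + 1) L,
      periodicEnergy v Ψ ≤ periodicGroundStateEnergy v (N + 1) L + δ →
      ENNReal.ofReal c ≤ taggedZeroModeOccupation N L Ψ.ψ := by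
    intro Ψ hΨE
    have h := hwin Ψ hΨE
    rw [← succ_mul_taggedZeroModeOccupation hL Ψ.ψ, ENNReal.ofReal_mul hc, hNreal, mul_comm] at h
    exact (ENNReal.mul_le_mul_iff_right hN0 hNtop).1 h
  -- `f₀(Φ₀) ≤ 1`
  have hf₀le : taggedZeroModeOccupation N L (fun X => (Φ₀ X : ℂ)) ≤ 1 :=
    (taggedZeroModeOccupation_le_lintegral hL hΦ₀m).trans_eq (lintegral_nnnorm_ofReal_sq_eq_one hΦ)
  -- Step 2: for every `ε > 0`, `c ≤ (1+ε) f₀(Φ₀) + ε`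
  have key : ∀ ε : ℝ, 0 < ε → ENNReal.ofReal c ≤
      ENNReal.ofReal (1 + ε) * taggedZeroModeOccupation N L (fun X => (Φ₀ X : ℂ)) +
        ENNReal.ofReal ε := by
    intro ε hε
    have hε0 : ε ≠ 0 := hε.ne'
    have hε1 : 1 + ε ≠ 0 := by positivity
    have hη : 0 < ε ^ 2 / (1 + ε) := by positivity
    obtain ⟨δ', hδ', hrig⟩ := rigidity_of_nearMinimiser hv hL hC hΦ hΦc hΦp hη
    -- a near-minimiser within `min δ (ofReal δ')`
    have hpos : min δ (ENNReal.ofReal δ') ≠ 0 := (lt_min hδ (ENNReal.ofReal_pos.2 hδ')).ne'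
    have hlt : periodicGroundStateEnergy v (N + 1) L <
        periodicGroundStateEnergy v (N + 1) L + min δ (ENNReal.ofReal δ') :=
      ENNReal.lt_add_right hΦ.energy_ne_top hpos
    obtain ⟨Ψ, hΨE⟩ : ∃ Ψ : PeriodicTrialState (N + 1) L,
        periodicEnergy v Ψ < periodicGroundStateEnergy v (N + 1) L + min δ (ENNReal.ofReal δ') :=
      iInf_lt_iff.1 hlt
    have hΨδ : periodicEnergy v Ψ ≤ periodicGroundStateEnergy v (N + 1) L + δ :=
      hΨE.le.trans (by gcongr; exact min_le_left _ _)
    have hΨδ' : periodicEnergy v Ψ ≤ periodicGroundStateEnergy v (N + 1) L + ENNReal.ofReal δ' :=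
      hΨE.le.trans (by gcongr; exact min_le_right _ _)
    obtain ⟨α, hα1, -, hαΨ⟩ := hrig Ψ hΨδ'
    have hcΨ := hwin' Ψ hΨδ
    -- measurability, bounds, slice integrability
    have hΨm : Measurable Ψ.ψ := Ψ.contDiff.continuous.measurable
    have hFm : Measurable fun X => α * (Φ₀ X : ℂ) := measurable_const.mul hΦ₀m
    have hRm : Measurable fun X => Ψ.ψ X - α * (Φ₀ X : ℂ) := hΨm.sub hFm
    obtain ⟨BΨ, hBΨ⟩ := exists_norm_le_of_continuous_periodic hL Ψ.contDiff.continuous Ψ.periodic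
    obtain ⟨BΦ, -, hBΦ⟩ := exists_bound_of_continuous_periodic hL hΦc hΦ.periodic
    have hvol : volume (cell L) ≠ ⊤ := by
      rw [volume_cell]; exact (ENNReal.pow_lt_top ENNReal.ofReal_lt_top).ne
    have hFi : ∀ Y : Config N, IntegrableOn (fun x => α * (Φ₀ (vecCons x Y) : ℂ)) (cell L) :=
      fun Y => Measure.integrableOn_of_bounded hvol
        (measurable_comp_vecCons_left hFm Y).aestronglyMeasurable
        (Eventually.of_forall fun x => show ‖α * (Φ₀ (vecCons x Y) : ℂ)‖ ≤ ‖α‖ * BΦ by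
          rw [norm_mul, Complex.norm_real, Real.norm_eq_abs]
          exact mul_le_mul_of_nonneg_left (hBΦ _) (norm_nonneg _))
    have hΨi : ∀ Y : Config N, IntegrableOn (fun x => Ψ.ψ (vecCons x Y)) (cell L) :=
      fun Y => Measure.integrableOn_of_bounded hvol
        (measurable_comp_vecCons_left hΨm Y).aestronglyMeasurable (Eventually.of_forall fun x => hBΨ _)
    have hRi : ∀ Y : Config N,
        IntegrableOn (fun x => Ψ.ψ (vecCons x Y) - α * (Φ₀ (vecCons x Y) : ℂ)) (cell L) :=
      fun Y => (hΨi Y).sub (hFi Y)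
    -- the decomposition `Ψ = αΦ₀ + (Ψ - αΦ₀)`
    have hdec : taggedZeroModeOccupation N L Ψ.ψ = taggedZeroModeOccupation N L
        (fun X => α * (Φ₀ X : ℂ) + (Ψ.ψ X - α * (Φ₀ X : ℂ))) := by
      congr 1; funext X; ring
    -- the remainder is small, the main part is at most `f₀(Φ₀)`
    have hRsmall : taggedZeroModeOccupation N L (fun X => Ψ.ψ X - α * (Φ₀ X : ℂ)) ≤
        ENNReal.ofReal (ε ^ 2 / (1 + ε)) :=
      (taggedZeroModeOccupation_le_lintegral hL hRm).trans hαΨ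
    have hα2 : ((‖α‖₊ : ℝ≥0∞)) ^ 2 ≤ 1 := by
      rw [nnnorm_coe_sq_eq_ofReal]
      exact ENNReal.ofReal_le_one.2 (pow_le_one₀ (norm_nonneg _) hα1)
    have hFle : taggedZeroModeOccupation N L (fun X => α * (Φ₀ X : ℂ)) ≤
        taggedZeroModeOccupation N L (fun X => (Φ₀ X : ℂ)) := by
      rw [taggedZeroModeOccupation_const_mul]
      exact mul_le_of_le_one_left zero_le hα2
    have hεalg : ENNReal.ofReal (1 + ε⁻¹) * ENNReal.ofReal (ε ^ 2 / (1 + ε)) = ENNReal.ofReal ε := by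
      rw [← ENNReal.ofReal_mul (by positivity)]
      congr 1
      field_simp
      ring
    calc ENNReal.ofReal c ≤ taggedZeroModeOccupation N L Ψ.ψ := hcΨ
      _ = _ := hdec
      _ ≤ ENNReal.ofReal (1 + ε) * taggedZeroModeOccupation N L (fun X => α * (Φ₀ X : ℂ)) +
            ENNReal.ofReal (1 + ε⁻¹) *
              taggedZeroModeOccupation N L (fun X => Ψ.ψ X - α * (Φ₀ X : ℂ)) :=
          taggedZeroModeOccupation_add_le hFm hRm hFi hRi hε
      _ ≤ ENNReal.ofReal (1 + ε) * taggedZeroModeOccupation N L (fun X => (Φ₀ X : ℂ)) +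
            ENNReal.ofReal (1 + ε⁻¹) * ENNReal.ofReal (ε ^ 2 / (1 + ε)) := by
          gcongr
      _ = _ := by rw [hεalg]
  -- Step 3: let `ε → 0`
  refine ENNReal.le_of_forall_pos_le_add fun s hs _ => ?_
  have hε : (0 : ℝ) < s / 2 := half_pos (NNReal.coe_pos.2 hs)
  set f₀ := taggedZeroModeOccupation N L (fun X => (Φ₀ X : ℂ)) with hf₀
  calc ENNReal.ofReal c ≤ ENNReal.ofReal (1 + s / 2) * f₀ + ENNReal.ofReal (s / 2) := key _ hε
    _ = f₀ + ENNReal.ofReal (s / 2) * f₀ + ENNReal.ofReal (s / 2) := by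
        rw [ENNReal.ofReal_add zero_le_one hε.le, ENNReal.ofReal_one, add_mul, one_mul]
    _ ≤ f₀ + ENNReal.ofReal (s / 2) * 1 + ENNReal.ofReal (s / 2) := by gcongr
    _ = f₀ + s := by
        rw [mul_one, add_assoc, ← ENNReal.ofReal_add hε.le hε.le, add_halves,
          ENNReal.ofReal_coe_nnreal]

end Summit.AtomisticToContinuum.BoseEinsteinCondensation.Theorems.CorrectorClosure.ResidueAreaLaw

end
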